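import Literature.Computability.Complexity.HardcoreInapproximabilitySSC
import Mathlib.Data.Nat.Choose.Vandermonde
import Mathlib.Data.Nat.Choose.Sum
import HarnessLib

/-!
# Small subgraph conditioning — an abstract L² lower-tail bound

An abstract, finite-probability-space form of the small-subgraph-conditioning method of
Robinson–Wormald as used in [MosselWeitzWormald2008, Thm 4.1] and [Sly2010, proof of Thm 3.10]:
given a nonnegative `Y` on a finite uniform space `Ω`, counts `X_1,…,X_k`, and constants
`λ_i, δ_i ≥ 0` such that (U) the factorial moments of the `X_i` are bounded above by those of
independent Poissons `Po(λ_i)`, (P) the `Y`-tilted factorial moments are bounded below by those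
of `Po(λ_i(1+δ_i))`, and (S) `E[Y²] ≤ (1+ε₁) τ (EY)²`, the polynomial control variate
`W_B = Σ_{c ≤ B} Π_i C(X_i, c_i) δ_i^{c_i}` gives, by Cauchy–Schwarz / Chebyshev applied to
`Y - (EY/A_B)·W_B`-type combinations, the lower-tail estimate `ssc_lowerTail_le`:
`#{Y ≤ t·EY} ≤ ((1+ε₁)τ − (1−ε₁)² P_B²/((1+ε₁)A_B)) / ((1−ε₁)P_B/((1+ε₁)A_B) − t)² · |Ω|`,
where `A_B = E[W_B²]`-proxy (`sscA`) and `P_B` (`sscP`) are explicit finite sums.  When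
`exp(Σ λ_i δ_i²) → τ` the numerator can be made small, which is how it is used for Sly's
Theorem 3.10.  Also: the generating-function identities `hasSum_cycleWeights(_sq)` evaluating
`Σ_i λ_i δ_i²` and `Σ_i λ_i δ_i` for the cycle weights `λ_i = (q^{2i}+q)/(2i)`, `δ_i = r^i` of the
bipartite configuration model, and elementary bounds `sscA_le_exp`, `sscP_le_exp`, `tendsto_sscP`.

## References
* [MosselWeitzWormald2008] E. Mossel, D. Weitz, N. Wormald, *On the hardness of sampling
  independent sets beyond the tree threshold*, PTRF 143 (2009), Thm 4.1 and §4.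
* [Sly2010] A. Sly, *Computational transition at the uniqueness threshold*, FOCS 2010,
  arXiv:1005.5584, proof of Theorem 3.10.
-/

namespace Literature.Computability.Complexity

open Finset Nat

section BinomialProductR

/-- Product of binomial coefficients with a common upper argument (real form). [folklore] -/
theorem choose_mul_choose_eq_sum_real (x m m' : ℕ) :
    (x.choose m : ℝ) * (x.choose m' : ℝ) =
      ∑ k ∈ range (m' + 1), (m.choose k : ℝ) * ((m + (m' - k)).choose m : ℝ) * (x.choose (m + (m' - k)) : ℝ) := by
  have h : x.choose m * x.choose m' =
      ∑ k ∈ range (m' + 1), m.choose k * ((m + (m' - k)).choose m * x.choose (m + (m' - k))) := by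
    rcases le_or_gt m x with hmx | hmx
    · have hv : x.choose m' = ∑ ij ∈ antidiagonal m', m.choose ij.1 * (x - m).choose ij.2 := by
        conv_lhs => rw [← Nat.add_sub_cancel' hmx]
        exact Nat.add_choose_eq m (x - m) m'
      rw [hv, Finset.Nat.sum_antidiagonal_eq_sum_range_succ_mk, Finset.mul_sum]
      refine Finset.sum_congr rfl fun k hk => ?_
      dsimp only
      have h := Nat.choose_mul (n := x) (k := m + (m' - k)) (s := m) (by omega)
      rw [Nat.add_sub_cancel_left] at h
      calc x.choose m * (m.choose k * (x - m).choose (m' - k))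
          = m.choose k * (x.choose m * (x - m).choose (m' - k)) := by ring
        _ = m.choose k * (x.choose (m + (m' - k)) * (m + (m' - k)).choose m) := by rw [h]
        _ = _ := by ring
    · rw [Nat.choose_eq_zero_of_lt hmx, zero_mul]
      symm
      refine Finset.sum_eq_zero fun k _ => ?_
      rw [Nat.choose_eq_zero_of_lt (show x < m + (m' - k) by omega)]
      ring
  have := congrArg (Nat.cast : ℕ → ℝ) h
  push_cast at this
  rw [this]
  refine Finset.sum_congr rfl fun k _ => ?_
  ring

end BinomialProductR

section AbstractSSC

variable {Ω : Type*} {k : ℕ}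

/-- The binomial product `Π_i C(X_i(ω), c_i)`. [folklore] -/
noncomputable def sscBinom (X : Fin k → Ω → ℕ) (c : Fin k → ℕ) (ω : Ω) : ℝ :=
  ∏ i : Fin k, ((X i ω).choose (c i) : ℝ)

/-- The multi-indices `c ≤ B` coordinatewise. [folklore] -/
def sscBox (k B : ℕ) : Finset (Fin k → ℕ) := Fintype.piFinset fun _ => range (B + 1)

/-- **The polynomial control variate** `W_B = Σ_{c ≤ B} (Π_i δ_i^{c_i}) Π_i C(X_i, c_i)`. [folklore] -/
noncomputable def sscW (X : Fin k → Ω → ℕ) (δ : Fin k → ℝ) (B : ℕ) (ω : Ω) : ℝ :=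
  ∑ c ∈ sscBox k B, (∏ i, δ i ^ c i) * sscBinom X c ω

/-- The limit second moment of `W_B` for independent Poisson counts: `A_B(λ,δ)`. [folklore] -/
noncomputable def sscA (lam δ : Fin k → ℝ) (B : ℕ) : ℝ :=
  ∑ c ∈ sscBox k B, ∑ c' ∈ sscBox k B, (∏ i, δ i ^ c i) * (∏ i, δ i ^ c' i) *
    ∏ i, ∑ r ∈ range (c' i + 1),
      ((c i).choose r : ℝ) * (((c i) + (c' i - r)).choose (c i) : ℝ) * (lam i ^ (c i + (c' i - r)) / ((c i + (c' i - r))! : ℝ))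

/-- The limit planted first moment of `W_B`: `P_B(λ,δ) = Π_i Σ_{c ≤ B} (λ_i(1+δ_i)δ_i)^c/c!`. [folklore] -/
noncomputable def sscP (lam δ : Fin k → ℝ) (B : ℕ) : ℝ :=
  ∑ c ∈ sscBox k B, ∏ i, (lam i * (1 + δ i) * δ i) ^ c i / ((c i)! : ℝ)

variable {X : Fin k → Ω → ℕ} {δ lam : Fin k → ℝ} {B : ℕ}

/-- `0 ∈ sscBox`. [folklore] -/
theorem zero_mem_sscBox (k B : ℕ) : (fun _ => 0 : Fin k → ℕ) ∈ sscBox k B := by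
  simp [sscBox, Fintype.mem_piFinset]

/-- Membership in the box. [folklore] -/
theorem mem_sscBox {c : Fin k → ℕ} : c ∈ sscBox k B ↔ ∀ i, c i ≤ B := by
  simp [sscBox, Fintype.mem_piFinset]

/-- `sscBinom ≥ 0`. [folklore] -/
theorem sscBinom_nonneg (X : Fin k → Ω → ℕ) (c : Fin k → ℕ) (ω : Ω) : 0 ≤ sscBinom X c ω := by
  unfold sscBinom; positivity

/-- `sscBinom X 0 = 1`. [folklore] -/
theorem sscBinom_zero (X : Fin k → Ω → ℕ) (ω : Ω) : sscBinom X (fun _ => 0) ω = 1 := by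
  unfold sscBinom; simp

/-- `W_B ≥ 1` (the `c = 0` term). [folklore] -/
theorem one_le_sscW (hδ : ∀ i, 0 ≤ δ i) (ω : Ω) : 1 ≤ sscW X δ B ω := by
  unfold sscW
  rw [← Finset.add_sum_erase _ _ (zero_mem_sscBox k B)]
  simp only [pow_zero, Finset.prod_const_one, one_mul, sscBinom_zero]
  have : 0 ≤ ∑ c ∈ (sscBox k B).erase (fun _ => 0), (∏ i, δ i ^ c i) * sscBinom X c ω :=
    Finset.sum_nonneg fun c _ => mul_nonneg (Finset.prod_nonneg fun i _ => pow_nonneg (hδ i) _)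
      (sscBinom_nonneg X c ω)
  linarith

/-- **The square of the control variate in the binomial basis**:
`W_B(ω)² = Σ_{c,c'} δ^c δ^{c'} Π_i Σ_r C(c_i,r) C(c_i+c'_i-r, c_i) C(X_i(ω), c_i+c'_i-r)`. [folklore] -/
theorem sscW_sq (ω : Ω) :
    sscW X δ B ω ^ 2 = ∑ c ∈ sscBox k B, ∑ c' ∈ sscBox k B, (∏ i, δ i ^ c i) * (∏ i, δ i ^ c' i) *
      ∏ i, ∑ r ∈ range (c' i + 1),
        ((c i).choose r : ℝ) * (((c i) + (c' i - r)).choose (c i) : ℝ) * ((X i ω).choose (c i + (c' i - r)) : ℝ) := by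
  unfold sscW
  rw [sq, Finset.sum_mul_sum]
  refine Finset.sum_congr rfl fun c _ => Finset.sum_congr rfl fun c' _ => ?_
  unfold sscBinom
  rw [show (∏ i, δ i ^ c i) * (∏ i, ((X i ω).choose (c i) : ℝ)) * ((∏ i, δ i ^ c' i) * ∏ i, ((X i ω).choose (c' i) : ℝ)) =
    (∏ i, δ i ^ c i) * (∏ i, δ i ^ c' i) * ∏ i, (((X i ω).choose (c i) : ℝ) * ((X i ω).choose (c' i) : ℝ)) by
    rw [Finset.prod_mul_distrib]; ring]
  congr 1
  refine Finset.prod_congr rfl fun i _ => ?_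
  exact choose_mul_choose_eq_sum_real _ _ _

/-- **The abstract small-subgraph-conditioning bound (L² form).** On a finite space with counting
measure let `Y ≥ 0` with `Σ Y > 0` and counts `X_i`. If the binomial moments of the `X_i` of orders
`≤ 2B` are at most `(1+ε₁)` times the independent-Poisson values, the `Y`-planted binomial moments of
orders `≤ B` are at least `(1-ε₁)` times the tilted-Poisson values, and `|Ω| Σ Y² ≤ (1+ε₁) τ (Σ Y)²`,
then `#{Y ≤ t · avg Y} ≤ θ |Ω|` with
`θ = [(1+ε₁)τ - (1-ε₁)² P_B²/((1+ε₁)A_B)] / [(1-ε₁)P_B/((1+ε₁)A_B) - t]²`.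
[cite: Sly2010, Theorem 3.6 (after Janson / MWW09 Thm 4.2), in the L² control-variate form] -/
theorem ssc_lowerTail_le [Fintype Ω] (X : Fin k → Ω → ℕ) (Y : Ω → ℝ) (hYpos : 0 < ∑ ω, Y ω)
    {δ lam : Fin k → ℝ} (hδ : ∀ i, 0 ≤ δ i) (hlam : ∀ i, 0 ≤ lam i) (B : ℕ) {ε₁ τ t : ℝ}
    (hε₁ : 0 ≤ ε₁) (hε₁1 : ε₁ < 1)
    (hU : ∀ c : Fin k → ℕ, (∀ i, c i ≤ 2 * B) →
      ∑ ω, sscBinom X c ω ≤ (1 + ε₁) * Fintype.card Ω * ∏ i, lam i ^ c i / ((c i)! : ℝ))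
    (hP : ∀ c : Fin k → ℕ, (∀ i, c i ≤ B) →
      (1 - ε₁) * (∑ ω, Y ω) * ∏ i, (lam i * (1 + δ i)) ^ c i / ((c i)! : ℝ) ≤ ∑ ω, Y ω * sscBinom X c ω)
    (hS : (Fintype.card Ω : ℝ) * ∑ ω, Y ω ^ 2 ≤ (1 + ε₁) * τ * (∑ ω, Y ω) ^ 2)
    (hden : t < (1 - ε₁) * sscP lam δ B / ((1 + ε₁) * sscA lam δ B)) :
    haveI := Classical.decPred fun ω => Y ω ≤ t * ((∑ ω, Y ω) / Fintype.card Ω)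
    ((univ.filter fun ω => Y ω ≤ t * ((∑ ω, Y ω) / Fintype.card Ω)).card : ℝ) ≤
      ((1 + ε₁) * τ - (1 - ε₁) ^ 2 * sscP lam δ B ^ 2 / ((1 + ε₁) * sscA lam δ B)) /
        ((1 - ε₁) * sscP lam δ B / ((1 + ε₁) * sscA lam δ B) - t) ^ 2 * Fintype.card Ω := by
  classical
  have hΩ : 0 < (Fintype.card Ω : ℝ) := by
    have : Nonempty Ω := by
      by_contra h
      rw [not_nonempty_iff] at h
      simp at hYpos
    exact_mod_cast Fintype.card_pos
  set W := sscW X δ B with hWdef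
  set SY := ∑ ω, Y ω with hSY
  set SW2 := ∑ ω, W ω ^ 2 with hSW2
  set SYW := ∑ ω, Y ω * W ω with hSYW
  set A := sscA lam δ B with hA
  set P := sscP lam δ B with hP_def
  have hW1 : ∀ ω, 1 ≤ W ω := one_le_sscW hδ
  -- `P > 0`, `A > 0`
  have hP0 : 0 < P := by
    rw [hP_def]; unfold sscP
    rw [← Finset.add_sum_erase _ _ (zero_mem_sscBox k B)]
    simp only [pow_zero, Nat.factorial_zero, Nat.cast_one, div_one, Finset.prod_const_one]
    have : 0 ≤ ∑ c ∈ (sscBox k B).erase (fun _ => 0), ∏ i, (lam i * (1 + δ i) * δ i) ^ c i / ((c i)! : ℝ) :=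
      Finset.sum_nonneg fun c _ => Finset.prod_nonneg fun i _ => by
        have := hδ i; have := hlam i; positivity
    linarith
  -- `Σ W² ≤ (1+ε₁)|Ω| A`
  have hW2 : SW2 ≤ (1 + ε₁) * Fintype.card Ω * A := by
    rw [hSW2]
    simp_rw [hWdef, sscW_sq]
    rw [Finset.sum_comm]
    rw [hA]; unfold sscA
    rw [Finset.mul_sum]
    refine Finset.sum_le_sum fun c hc => ?_
    rw [Finset.sum_comm, Finset.mul_sum]
    refine Finset.sum_le_sum fun c' hc' => ?_
    rw [← Finset.mul_sum]
    have hcoef : 0 ≤ (∏ i, δ i ^ c i) * (∏ i, δ i ^ c' i) :=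
      mul_nonneg (Finset.prod_nonneg fun i _ => pow_nonneg (hδ i) _) (Finset.prod_nonneg fun i _ => pow_nonneg (hδ i) _)
    rw [show (1 + ε₁) * (Fintype.card Ω : ℝ) * ((∏ i, δ i ^ c i) * (∏ i, δ i ^ c' i) *
        ∏ i, ∑ r ∈ range (c' i + 1), ((c i).choose r : ℝ) * (((c i) + (c' i - r)).choose (c i) : ℝ) *
          (lam i ^ (c i + (c' i - r)) / ((c i + (c' i - r))! : ℝ))) =
      (∏ i, δ i ^ c i) * (∏ i, δ i ^ c' i) * ((1 + ε₁) * (Fintype.card Ω : ℝ) *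
        ∏ i, ∑ r ∈ range (c' i + 1), ((c i).choose r : ℝ) * (((c i) + (c' i - r)).choose (c i) : ℝ) *
          (lam i ^ (c i + (c' i - r)) / ((c i + (c' i - r))! : ℝ))) by ring]
    apply mul_le_mul_of_nonneg_left _ hcoef
    -- expand the product of sums over `r`-vectors and use `hU` termwise
    simp_rw [Finset.prod_univ_sum]
    rw [show ∑ ω, ∑ r ∈ Fintype.piFinset fun i => range (c' i + 1),
        ∏ i, ((c i).choose (r i) : ℝ) * (((c i) + (c' i - r i)).choose (c i) : ℝ) * ((X i ω).choose (c i + (c' i - r i)) : ℝ) =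
      ∑ r ∈ Fintype.piFinset fun i => range (c' i + 1),
        (∏ i, ((c i).choose (r i) : ℝ) * (((c i) + (c' i - r i)).choose (c i) : ℝ)) *
          ∑ ω, sscBinom X (fun i => c i + (c' i - r i)) ω by
      rw [Finset.sum_comm]
      refine Finset.sum_congr rfl fun r _ => ?_
      rw [Finset.mul_sum]
      refine Finset.sum_congr rfl fun ω _ => ?_
      unfold sscBinom
      rw [← Finset.prod_mul_distrib]]
    rw [Finset.mul_sum]
    refine Finset.sum_le_sum fun r hr => ?_
    have hcr : 0 ≤ ∏ i, ((c i).choose (r i) : ℝ) * (((c i) + (c' i - r i)).choose (c i) : ℝ) :=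
      Finset.prod_nonneg fun i _ => by positivity
    have hcb : ∀ i, c i + (c' i - r i) ≤ 2 * B := by
      intro i
      have h1 := (mem_sscBox.mp hc) i
      have h2 := (mem_sscBox.mp hc') i
      omega
    have := mul_le_mul_of_nonneg_left (hU (fun i => c i + (c' i - r i)) hcb) hcr
    refine le_trans this (le_of_eq ?_)
    rw [show (∏ i, ((c i).choose (r i) : ℝ) * (((c i) + (c' i - r i)).choose (c i) : ℝ)) *
        ((1 + ε₁) * (Fintype.card Ω : ℝ) * ∏ i, lam i ^ (c i + (c' i - r i)) / ((c i + (c' i - r i))! : ℝ)) =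
      (1 + ε₁) * (Fintype.card Ω : ℝ) * ((∏ i, ((c i).choose (r i) : ℝ) * (((c i) + (c' i - r i)).choose (c i) : ℝ)) *
        ∏ i, lam i ^ (c i + (c' i - r i)) / ((c i + (c' i - r i))! : ℝ)) by ring]
    congr 1
    rw [← Finset.prod_mul_distrib]
  -- `Σ Y W ≥ (1-ε₁) SY P`
  have hYW : (1 - ε₁) * SY * P ≤ SYW := by
    rw [hSYW]
    simp_rw [hWdef, sscW, Finset.mul_sum]
    rw [Finset.sum_comm]
    rw [hP_def]; unfold sscP
    rw [Finset.mul_sum]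
    refine Finset.sum_le_sum fun c hc => ?_
    have hc' := mem_sscBox.mp hc
    have h := hP c hc'
    have hcoef : 0 ≤ ∏ i, δ i ^ c i := Finset.prod_nonneg fun i _ => pow_nonneg (hδ i) _
    calc (1 - ε₁) * SY * ∏ i, (lam i * (1 + δ i) * δ i) ^ c i / ((c i)! : ℝ)
        = (∏ i, δ i ^ c i) * ((1 - ε₁) * SY * ∏ i, (lam i * (1 + δ i)) ^ c i / ((c i)! : ℝ)) := by
          rw [show ∏ i, (lam i * (1 + δ i) * δ i) ^ c i / ((c i)! : ℝ) =
              (∏ i, δ i ^ c i) * ∏ i, (lam i * (1 + δ i)) ^ c i / ((c i)! : ℝ) by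
            rw [← Finset.prod_mul_distrib]
            refine Finset.prod_congr rfl fun i _ => ?_
            rw [mul_pow]; ring]
          ring
      _ ≤ (∏ i, δ i ^ c i) * ∑ ω, Y ω * sscBinom X c ω := mul_le_mul_of_nonneg_left h hcoef
      _ = ∑ ω, Y ω * ((∏ i, δ i ^ c i) * sscBinom X c ω) := by rw [Finset.mul_sum]; refine Finset.sum_congr rfl fun ω _ => ?_; ring
  -- positivity of the optimal coefficient
  have hSW2pos : 0 < SW2 := by
    rw [hSW2]
    have : ∀ ω, (1:ℝ) ≤ W ω ^ 2 := fun ω => by nlinarith [hW1 ω]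
    calc (0:ℝ) < ∑ _ω : Ω, (1:ℝ) := by rw [Finset.sum_const, nsmul_eq_mul, mul_one]; exact hΩ
      _ ≤ _ := Finset.sum_le_sum fun ω _ => this ω
  have hA0 : 0 < A := by
    have : SW2 ≤ (1 + ε₁) * Fintype.card Ω * A := hW2
    by_contra hle
    push Not at hle
    have : (1 + ε₁) * (Fintype.card Ω : ℝ) * A ≤ 0 :=
      mul_nonpos_of_nonneg_of_nonpos (by positivity) hle
    linarith
  set c₀ := SYW / SW2 with hc₀
  have hc₀ge : (1 - ε₁) * SY * P / ((1 + ε₁) * Fintype.card Ω * A) ≤ c₀ := by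
    rw [hc₀]
    have h1 : (1 - ε₁) * SY * P / ((1 + ε₁) * Fintype.card Ω * A) ≤ (1 - ε₁) * SY * P / SW2 :=
      div_le_div_of_nonneg_left (by have := hYpos; positivity) hSW2pos hW2
    exact le_trans h1 (div_le_div_of_nonneg_right hYW hSW2pos.le)
  set avg := SY / Fintype.card Ω with havg
  have havg0 : 0 < avg := by positivity
  -- the threshold is below `c₀`
  have hgap : avg * ((1 - ε₁) * P / ((1 + ε₁) * A) - t) ≤ c₀ - t * avg := by
    have e : avg * ((1 - ε₁) * P / ((1 + ε₁) * A)) = (1 - ε₁) * SY * P / ((1 + ε₁) * Fintype.card Ω * A) := by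
      rw [havg]; field_simp
    nlinarith [hc₀ge, e]
  have hct : t * avg < c₀ := by
    have : 0 < avg * ((1 - ε₁) * P / ((1 + ε₁) * A) - t) := mul_pos havg0 (by linarith)
    linarith
  have hc₀0 : 0 ≤ c₀ := by rw [hc₀]; exact div_nonneg (le_trans (by have := hYpos; positivity) hYW) hSW2pos.le
  -- the L² bound
  have hL := card_lowerTail_mul_sq_le_sum_sq Y W hW1 hc₀0 hct
  rw [hc₀, sum_sq_sub_optimal Y W hSW2pos, ← hc₀] at hL
  -- numerator bound
  have hnum : ∑ ω, Y ω ^ 2 - SYW ^ 2 / SW2 ≤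
      avg ^ 2 * Fintype.card Ω * ((1 + ε₁) * τ - (1 - ε₁) ^ 2 * P ^ 2 / ((1 + ε₁) * A)) := by
    have h1 : ∑ ω, Y ω ^ 2 ≤ (1 + ε₁) * τ * SY ^ 2 / Fintype.card Ω := by
      rw [le_div_iff₀ hΩ]; linarith [hS]
    have h2 : ((1 - ε₁) * SY * P) ^ 2 / ((1 + ε₁) * Fintype.card Ω * A) ≤ SYW ^ 2 / SW2 := by
      have hnn : 0 ≤ (1 - ε₁) * SY * P := by have := hYpos; positivity
      calc ((1 - ε₁) * SY * P) ^ 2 / ((1 + ε₁) * Fintype.card Ω * A)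
          ≤ SYW ^ 2 / ((1 + ε₁) * Fintype.card Ω * A) :=
            div_le_div_of_nonneg_right (pow_le_pow_left₀ hnn hYW 2) (by positivity)
        _ ≤ SYW ^ 2 / SW2 := div_le_div_of_nonneg_left (by positivity) hSW2pos hW2
    have e : avg ^ 2 * Fintype.card Ω * ((1 + ε₁) * τ - (1 - ε₁) ^ 2 * P ^ 2 / ((1 + ε₁) * A)) =
        (1 + ε₁) * τ * SY ^ 2 / Fintype.card Ω - ((1 - ε₁) * SY * P) ^ 2 / ((1 + ε₁) * Fintype.card Ω * A) := by
      rw [havg]; field_simp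
    linarith [h1, h2, e]
  -- combine
  have hden0 : 0 < (1 - ε₁) * P / ((1 + ε₁) * A) - t := by linarith
  have hsq : avg ^ 2 * ((1 - ε₁) * P / ((1 + ε₁) * A) - t) ^ 2 ≤ (c₀ - t * avg) ^ 2 := by
    have := pow_le_pow_left₀ (by positivity) hgap 2
    rw [mul_pow] at this; exact this
  have hcard0 : 0 ≤ ((univ.filter fun ω => Y ω ≤ t * avg).card : ℝ) := by positivity
  have key : ((univ.filter fun ω => Y ω ≤ t * avg).card : ℝ) * (avg ^ 2 * ((1 - ε₁) * P / ((1 + ε₁) * A) - t) ^ 2) ≤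
      avg ^ 2 * Fintype.card Ω * ((1 + ε₁) * τ - (1 - ε₁) ^ 2 * P ^ 2 / ((1 + ε₁) * A)) :=
    le_trans (le_trans (mul_le_mul_of_nonneg_left hsq hcard0) hL) hnum
  rw [show t * (SY / Fintype.card Ω) = t * avg by rw [havg]] at *
  have havg2 : 0 < avg ^ 2 := by positivity
  rw [div_mul_eq_mul_div, le_div_iff₀ (pow_pos hden0 2)]
  have h2 : ((univ.filter fun ω => Y ω ≤ t * avg).card : ℝ) * ((1 - ε₁) * P / ((1 + ε₁) * A) - t) ^ 2 * avg ^ 2 ≤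
      ((1 + ε₁) * τ - (1 - ε₁) ^ 2 * P ^ 2 / ((1 + ε₁) * A)) * Fintype.card Ω * avg ^ 2 := by
    calc ((univ.filter fun ω => Y ω ≤ t * avg).card : ℝ) * ((1 - ε₁) * P / ((1 + ε₁) * A) - t) ^ 2 * avg ^ 2
        = ((univ.filter fun ω => Y ω ≤ t * avg).card : ℝ) * (avg ^ 2 * ((1 - ε₁) * P / ((1 + ε₁) * A) - t) ^ 2) := by ring
      _ ≤ avg ^ 2 * Fintype.card Ω * ((1 + ε₁) * τ - (1 - ε₁) ^ 2 * P ^ 2 / ((1 + ε₁) * A)) := key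
      _ = _ := by ring
  exact le_of_mul_le_mul_right h2 havg2

end AbstractSSC

section PoissonWorld

open Filter Topology

variable {k : ℕ}

/-- `P_B` is a product of partial exponential sums. [folklore] -/
theorem sscP_eq_prod (lam δ : Fin k → ℝ) (B : ℕ) :
    sscP lam δ B = ∏ i : Fin k, ∑ c ∈ range (B + 1), (lam i * (1 + δ i) * δ i) ^ c / (c ! : ℝ) := by
  unfold sscP sscBox
  rw [Finset.prod_univ_sum]

/-- `P_B ≤ P_∞ = Π_i e^{λ_i(1+δ_i)δ_i}`. [folklore] -/
theorem sscP_le_exp {lam δ : Fin k → ℝ} (hlam : ∀ i, 0 ≤ lam i) (hδ : ∀ i, 0 ≤ δ i) (B : ℕ) :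
    sscP lam δ B ≤ ∏ i : Fin k, Real.exp (lam i * (1 + δ i) * δ i) := by
  rw [sscP_eq_prod]
  refine Finset.prod_le_prod (fun i _ => Finset.sum_nonneg fun c _ => by have := hlam i; have := hδ i; positivity)
    fun i _ => ?_
  exact Real.sum_le_exp_of_nonneg (by have := hlam i; have := hδ i; positivity) _

/-- `P_B → P_∞`. [folklore] -/
theorem tendsto_sscP (lam δ : Fin k → ℝ) :
    Tendsto (fun B => sscP lam δ B) atTop (𝓝 (∏ i : Fin k, Real.exp (lam i * (1 + δ i) * δ i))) := by
  simp_rw [sscP_eq_prod]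
  refine tendsto_finsetProd _ fun i _ => ?_
  have h := (NormedSpace.expSeries_div_hasSum_exp (lam i * (1 + δ i) * δ i)).tendsto_sum_nat
  rw [← Real.exp_eq_exp_ℝ] at h
  exact h.comp (tendsto_add_atTop_nat 1)

/-- One coordinate of `A_B` is at most `e^{λ(2δ+δ²)}`. [folklore] -/
theorem sscA_coord_le {lam δ : ℝ} (hlam : 0 ≤ lam) (hδ : 0 ≤ δ) (B : ℕ) :
    ∑ c ∈ range (B + 1), ∑ c' ∈ range (B + 1), δ ^ c * δ ^ c' *
        ∑ r ∈ range (c' + 1), (c.choose r : ℝ) * ((c + (c' - r)).choose c : ℝ) * (lam ^ (c + (c' - r)) / ((c + (c' - r))! : ℝ)) ≤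
      Real.exp (lam * (2 * δ + δ ^ 2)) := by
  -- `F c c' r ≥ 0`
  set F : ℕ → ℕ → ℕ → ℝ := fun c c' r =>
    δ ^ c * δ ^ c' * ((c.choose r : ℝ) * ((c + (c' - r)).choose c : ℝ) * (lam ^ (c + (c' - r)) / ((c + (c' - r))! : ℝ))) with hF
  have hF0 : ∀ c c' r, 0 ≤ F c c' r := fun c c' r => by rw [hF]; positivity
  have hlhs : ∑ c ∈ range (B + 1), ∑ c' ∈ range (B + 1), δ ^ c * δ ^ c' *
      ∑ r ∈ range (c' + 1), (c.choose r : ℝ) * ((c + (c' - r)).choose c : ℝ) * (lam ^ (c + (c' - r)) / ((c + (c' - r))! : ℝ)) =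
      ∑ c ∈ range (B + 1), ∑ c' ∈ range (B + 1), ∑ r ∈ range (c' + 1), F c c' r := by
    refine Finset.sum_congr rfl fun c _ => Finset.sum_congr rfl fun c' _ => ?_
    rw [hF, Finset.mul_sum]
  rw [hlhs]
  -- reindex the inner double sum: `(c', r) ↦ (r, u = c' - r)`
  have hinner : ∀ c ∈ range (B + 1), ∑ c' ∈ range (B + 1), ∑ r ∈ range (c' + 1), F c c' r ≤
      ∑ r ∈ range (B + 1), ∑ u ∈ range (B + 1), F c (r + u) r := by
    intro c hc
    have h1 : ∑ c' ∈ range (B + 1), ∑ r ∈ range (c' + 1), F c c' r =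
        ∑ c' ∈ range (B + 1), ∑ r ∈ range (B + 1), if r ≤ c' then F c c' r else 0 := by
      refine Finset.sum_congr rfl fun c' hc' => ?_
      rw [Finset.mem_range] at hc'
      rw [Finset.sum_ite, Finset.sum_const_zero, add_zero]
      congr 1
      ext r; simp only [Finset.mem_range, Finset.mem_filter]; omega
    rw [h1, Finset.sum_comm]
    refine Finset.sum_le_sum fun r hr => ?_
    rw [Finset.mem_range] at hr
    have h2 : ∑ c' ∈ range (B + 1), (if r ≤ c' then F c c' r else 0) = ∑ c' ∈ Finset.Ico r (B + 1), F c c' r := by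
      rw [Finset.sum_ite, Finset.sum_const_zero, add_zero]
      congr 1
      ext c'; simp only [Finset.mem_range, Finset.mem_filter, Finset.mem_Ico]; omega
    rw [h2, Finset.sum_Ico_eq_sum_range]
    calc ∑ u ∈ range (B + 1 - r), F c (r + u) r ≤ ∑ u ∈ range (B + 1), F c (r + u) r :=
          Finset.sum_le_sum_of_subset_of_nonneg (Finset.range_subset_range.mpr (by omega)) fun u _ _ => hF0 _ _ _
      _ = _ := rfl
  refine le_trans (Finset.sum_le_sum hinner) ?_
  -- evaluate: `F c (r+u) r = C(c,r) δ^r · δ^u λ^{c+u}/(c! u!) · δ^c`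
  have hval : ∀ c r u : ℕ, F c (r + u) r = ((c.choose r : ℝ) * δ ^ r) * ((δ * lam) ^ u / (u ! : ℝ)) * ((δ * lam) ^ c / (c ! : ℝ)) := by
    intro c r u
    rw [hF]; dsimp only
    rw [show r + u - r = u by omega]
    have hcu : ((c + u).choose c : ℝ) * (c ! : ℝ) * (u ! : ℝ) = ((c + u)! : ℝ) := by
      have := Nat.choose_mul_factorial_mul_factorial (Nat.le_add_right c u)
      rw [Nat.add_sub_cancel_left] at this
      exact_mod_cast this
    have hc0 : (c ! : ℝ) ≠ 0 := by positivity
    have hu0 : (u ! : ℝ) ≠ 0 := by positivity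
    have hC0 : ((c + u).choose c : ℝ) ≠ 0 := by
      have : 0 < (c + u).choose c := Nat.choose_pos (Nat.le_add_right c u)
      exact_mod_cast this.ne'
    rw [← hcu]
    field_simp
    ring
  simp_rw [hval]
  -- sum over `u`, then `r`, then `c`
  have hu : ∀ c r : ℕ, ∑ u ∈ range (B + 1), ((c.choose r : ℝ) * δ ^ r) * ((δ * lam) ^ u / (u ! : ℝ)) * ((δ * lam) ^ c / (c ! : ℝ)) ≤
      ((c.choose r : ℝ) * δ ^ r) * Real.exp (δ * lam) * ((δ * lam) ^ c / (c ! : ℝ)) := by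
    intro c r
    rw [← Finset.sum_mul, ← Finset.mul_sum]
    apply mul_le_mul_of_nonneg_right _ (by positivity)
    exact mul_le_mul_of_nonneg_left (Real.sum_le_exp_of_nonneg (by positivity) _) (by positivity)
  have hr : ∀ c ∈ range (B + 1), ∑ r ∈ range (B + 1), ((c.choose r : ℝ) * δ ^ r) * Real.exp (δ * lam) * ((δ * lam) ^ c / (c ! : ℝ)) =
      (1 + δ) ^ c * Real.exp (δ * lam) * ((δ * lam) ^ c / (c ! : ℝ)) := by
    intro c hc
    rw [Finset.mem_range] at hc
    rw [← Finset.sum_mul, ← Finset.sum_mul]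
    congr 2
    rw [one_add_pow_eq_sum_choose]
    symm
    apply Finset.sum_subset (Finset.range_subset_range.mpr (by omega))
    intro r hr hr'
    rw [Finset.mem_range] at hr hr'
    rw [Nat.choose_eq_zero_of_lt (by omega)]; simp
  calc ∑ c ∈ range (B + 1), ∑ r ∈ range (B + 1), ∑ u ∈ range (B + 1),
        ((c.choose r : ℝ) * δ ^ r) * ((δ * lam) ^ u / (u ! : ℝ)) * ((δ * lam) ^ c / (c ! : ℝ))
      ≤ ∑ c ∈ range (B + 1), ∑ r ∈ range (B + 1), ((c.choose r : ℝ) * δ ^ r) * Real.exp (δ * lam) * ((δ * lam) ^ c / (c ! : ℝ)) :=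
        Finset.sum_le_sum fun c _ => Finset.sum_le_sum fun r _ => hu c r
    _ = ∑ c ∈ range (B + 1), (1 + δ) ^ c * Real.exp (δ * lam) * ((δ * lam) ^ c / (c ! : ℝ)) := Finset.sum_congr rfl hr
    _ = Real.exp (δ * lam) * ∑ c ∈ range (B + 1), ((1 + δ) * (δ * lam)) ^ c / (c ! : ℝ) := by
        rw [Finset.mul_sum]; refine Finset.sum_congr rfl fun c _ => ?_; simp only [mul_pow]; ring
    _ ≤ Real.exp (δ * lam) * Real.exp ((1 + δ) * (δ * lam)) :=
        mul_le_mul_of_nonneg_left (Real.sum_le_exp_of_nonneg (by positivity) _) (Real.exp_pos _).le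
    _ = Real.exp (lam * (2 * δ + δ ^ 2)) := by rw [← Real.exp_add]; congr 1; ring

/-- **`A_B ≤ A_∞ = Π_i e^{λ_i(2δ_i+δ_i²)}`**. [folklore] -/
theorem sscA_le_exp {lam δ : Fin k → ℝ} (hlam : ∀ i, 0 ≤ lam i) (hδ : ∀ i, 0 ≤ δ i) (B : ℕ) :
    sscA lam δ B ≤ ∏ i : Fin k, Real.exp (lam i * (2 * δ i + δ i ^ 2)) := by
  unfold sscA sscBox
  -- factorise over the coordinates
  have hfac : ∑ c ∈ Fintype.piFinset (fun _ : Fin k => range (B + 1)), ∑ c' ∈ Fintype.piFinset (fun _ : Fin k => range (B + 1)),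
      (∏ i, δ i ^ c i) * (∏ i, δ i ^ c' i) *
        ∏ i, ∑ r ∈ range (c' i + 1), ((c i).choose r : ℝ) * (((c i) + (c' i - r)).choose (c i) : ℝ) *
          (lam i ^ (c i + (c' i - r)) / ((c i + (c' i - r))! : ℝ)) =
      ∏ i : Fin k, ∑ c ∈ range (B + 1), ∑ c' ∈ range (B + 1), δ i ^ c * δ i ^ c' *
        ∑ r ∈ range (c' + 1), (c.choose r : ℝ) * ((c + (c' - r)).choose c : ℝ) * (lam i ^ (c + (c' - r)) / ((c + (c' - r))! : ℝ)) := by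
    rw [Finset.prod_univ_sum]
    refine Finset.sum_congr rfl fun c _ => ?_
    rw [Finset.prod_univ_sum]
    refine Finset.sum_congr rfl fun c' _ => ?_
    rw [Finset.prod_mul_distrib, Finset.prod_mul_distrib]
  rw [hfac]
  exact Finset.prod_le_prod (fun i _ => Finset.sum_nonneg fun c _ => Finset.sum_nonneg fun c' _ => by
      have := hlam i; have := hδ i; positivity)
    fun i _ => sscA_coord_le (hlam i) (hδ i) B

/-- **The cycle-weight series**: for `0 ≤ x < 1`, `Σ_{j ≥ 1} x^j/(2j) = -½ log(1-x)`. [folklore] -/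
theorem hasSum_pow_div_two_mul {x : ℝ} (hx0 : 0 ≤ x) (hx1 : x < 1) :
    HasSum (fun i : ℕ => x ^ (i + 1) / (2 * ((i : ℝ) + 1))) (-(1 / 2) * Real.log (1 - x)) := by
  have h := (Real.hasSum_pow_div_log_of_abs_lt_one (by rw [abs_lt]; constructor <;> linarith : |x| < 1)).div_const 2
  have hf : (fun i : ℕ => x ^ (i + 1) / (2 * ((i : ℝ) + 1))) = fun i : ℕ => x ^ (i + 1) / ((i : ℝ) + 1) / 2 := by
    funext i
    rw [div_div, mul_comm]
  rw [hf, show -(1 / 2) * Real.log (1 - x) = -Real.log (1 - x) / 2 by ring]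
  exact h

/-- **Sly's/MWW's constant as the exponential of the cycle series**:
`exp(Σ_i λ_i δ_i²) = (1 - q²r²)^{-1/2} (1 - r²)^{-q/2}` with `λ_i = (q^{2(i+1)}+q)/(2(i+1))`,
`δ_i = r^{i+1}` (`0 ≤ r`, `q r < 1`). [cite: MosselWeitzWormald2008, Lemma 7.6; Sly2010, Lemma 3.9] -/
theorem hasSum_cycleWeights_sq {q : ℕ} {r : ℝ} (hr0 : 0 ≤ r) (hqr : (q : ℝ) * r < 1) (hr1 : r < 1) :
    HasSum (fun i : ℕ => ((q : ℝ) ^ (2 * (i + 1)) + q) / (2 * ((i : ℝ) + 1)) * (r ^ (i + 1)) ^ 2)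
      (-(1 / 2) * Real.log (1 - ((q : ℝ) * r) ^ 2) + (q : ℝ) * (-(1 / 2) * Real.log (1 - r ^ 2))) := by
  have hq0 : (0 : ℝ) ≤ q := Nat.cast_nonneg q
  have hx1 : ((q : ℝ) * r) ^ 2 < 1 := by
    have : 0 ≤ (q : ℝ) * r := by positivity
    nlinarith
  have hx2 : r ^ 2 < 1 := by nlinarith
  have h1 := hasSum_pow_div_two_mul (x := ((q : ℝ) * r) ^ 2) (by positivity) hx1
  have h2 := (hasSum_pow_div_two_mul (x := r ^ 2) (by positivity) hx2).mul_left (q : ℝ)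
  have hf : (fun i : ℕ => ((q : ℝ) ^ (2 * (i + 1)) + q) / (2 * ((i : ℝ) + 1)) * (r ^ (i + 1)) ^ 2) =
      fun i : ℕ => (((q : ℝ) * r) ^ 2) ^ (i + 1) / (2 * ((i : ℝ) + 1)) + (q : ℝ) * ((r ^ 2) ^ (i + 1) / (2 * ((i : ℝ) + 1))) := by
    funext i
    rw [show (((q : ℝ) * r) ^ 2) ^ (i + 1) = (q : ℝ) ^ (2 * (i + 1)) * (r ^ (i + 1)) ^ 2 by ring,
      show (r ^ 2) ^ (i + 1) = (r ^ (i + 1)) ^ 2 by ring]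
    ring
  rw [hf]
  exact h1.add h2

/-- The linear cycle-weight series `Σ λ_i δ_i` converges (to `L`) when `q² r < 1`. [folklore] -/
theorem hasSum_cycleWeights {q : ℕ} {r : ℝ} (hr0 : 0 ≤ r) (hqr : (q : ℝ) ^ 2 * r < 1) (hr1 : r < 1) :
    HasSum (fun i : ℕ => ((q : ℝ) ^ (2 * (i + 1)) + q) / (2 * ((i : ℝ) + 1)) * r ^ (i + 1))
      (-(1 / 2) * Real.log (1 - (q : ℝ) ^ 2 * r) + (q : ℝ) * (-(1 / 2) * Real.log (1 - r))) := by
  have hq0 : (0 : ℝ) ≤ q := Nat.cast_nonneg q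
  have h1 := hasSum_pow_div_two_mul (x := (q : ℝ) ^ 2 * r) (by positivity) hqr
  have h2 := (hasSum_pow_div_two_mul (x := r) hr0 hr1).mul_left (q : ℝ)
  have hf : (fun i : ℕ => ((q : ℝ) ^ (2 * (i + 1)) + q) / (2 * ((i : ℝ) + 1)) * r ^ (i + 1)) =
      fun i : ℕ => ((q : ℝ) ^ 2 * r) ^ (i + 1) / (2 * ((i : ℝ) + 1)) + (q : ℝ) * (r ^ (i + 1) / (2 * ((i : ℝ) + 1))) := by
    funext i
    rw [show ((q : ℝ) ^ 2 * r) ^ (i + 1) = (q : ℝ) ^ (2 * (i + 1)) * r ^ (i + 1) by ring]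
    ring
  rw [hf]
  exact h1.add h2

end PoissonWorld

end Literature.Computability.Complexity
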